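import Literature.NumberTheory.EllipticCurves.HasseWeilAbelianInertiaInvariants
import Literature.NumberTheory.EllipticCurves.HasseWeilAbelianInertiaInvariantsProofs
import Literature.NumberTheory.EllipticCurves.InertiaInvariantsAdditiveProofs
import Literature.NumberTheory.EllipticCurves.TorsionCardinality
import HarnessLib

/-!
# The fundamental isomorphism `(V_ℓ E)^{I_𝔓} ≅ V_ℓ(Ẽ_ns(k̄_v))` is a theorem (Silverman *ATAEC*, proof of IV.10.2(a))

`Proofs` file (theorems only, no definitions, no named facts) in topic
`NumberTheory/EllipticCurves`, sibling of `HasseWeilAbelianInertiaInvariants` and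
`HasseWeilAbelianInertiaInvariantsProofs`.  It **discharges** the named fact

* `WeierstrassCurve.nonempty_fixedSubmodule_inertia_rationalTate_equiv_reductionPoints W ℓ`
  (`HasseWeilAbelianInertiaInvariants`) — Serre–Tate's *fundamental isomorphism*
  `V_ℓ(E(K̄))^{I(K̄/K)} ≅ V_ℓ(Ẽ_ns(k̄))` of Silverman, *Advanced Topics in the Arithmetic of
  Elliptic Curves*, proof of Thm. IV.10.2(a) (PDF p. 359 of the held copy: *"which proves the
  fundamental isomorphism"*; Serre–Tate 1968, §1 Lemma 2), for an elliptic curve over a number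
  field `K`, a prime `ℓ`, a finite place `v ∤ ℓ` and a prime `𝔓 ∣ v` of `\bar ℤ_K` —

as `WeierstrassCurve.nonempty_fixedSubmodule_inertia_rationalTate_equiv_reductionPoints_holds`.

## The proof

The fact asserts the existence of a `ℚ_ℓ`-linear isomorphism between two `ℚ_ℓ`-vector spaces,
so it is equivalent to: both are finite-dimensional of the same dimension.  Both dimensions are
theorems of the tree, case by case along the local trichotomy (Silverman, *AEC* VII.5.1;
`hasGoodReductionAt_or_hasMultiplicativeReductionAt_or_hasAdditiveReductionAt`):

* `dim (V_ℓ E)^{I_𝔓} = 2 - codim (V_ℓ E)^{I_𝔓}` (`ContinuousRep.codimFixed_eq_finrank_sub`,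
  `dim V_ℓ E = 2` = *AEC* III.7.1, `finrank_rationalTateModule_eq_two_holds`), and the codimension
  is `0 / 1 / 2` at good / multiplicative / additive `v` — Silverman *ATAEC* Thm. IV.10.2(a), all
  three cases of which are theorems of the tree
  (`codimFixed_inertia_rationalTate_eq_zero_of_hasGoodReductionAt`, *AEC* VII.4.1(b);
  `codimFixed_inertia_rationalTate_eq_one_of_hasMultiplicativeReductionAt_holds` and
  `codimFixed_inertia_rationalTate_eq_two_of_hasAdditiveReductionAt_holds`, proved in
  `InertiaInvariantsKodairaNeron{Multiplicative,Additive}Proofs` by running exactly the printed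
  Serre–Tate argument `V_ℓ(E(K^nr)) ≃ V_ℓ(E₀(K^nr)) ≃ V_ℓ(Ẽ_ns(k̄))` on the Kodaira–Néron
  finiteness, the reduction homomorphism and the divisibility of the kernel of reduction);
* `dim V_ℓ(Ẽ_ns(k̄_v)) = 2 / 1 / 0` from the torsion counts `#Ẽ_ns(k̄_v)[ℓⁿ] = ℓ^{2n} / ℓⁿ / 1`
  (`TateModule`/`TateModuleRank`: `RationalTateModule.finrank_eq_of_card_torsionBy`,
  `finite_of_card_torsionBy_rank`): at a good place `Ẽ_v` is an elliptic curve over `k̄_v`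
  (Mathlib `hasGoodReduction_iff_isElliptic_reduction`) and `#Ẽ(k̄)[n] = n²` for `n ≠ 0` in `k̄`
  (*AEC* III.6.4(b), `WeierstrassCurve.card_torsionBy_eq_sq`, `TorsionCardinality`); at a
  multiplicative place `Ẽ_ns(k̄) ≅ k̄ˣ` (*AEC* III.2.5, `nonempty_point_addEquiv_units_of_node`)
  with `#μ_{ℓⁿ}(k̄) = ℓⁿ`; at an additive place `Ẽ_ns(k̄) ≅ k̄⁺` (`nonempty_point_addEquiv_of_cusp`)
  has no `ℓ`-torsion — "using the fact that `ℓ ≠ p`" (PDF p. 359).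

Then `LinearEquiv.ofFinrankEq`.  This is the printed computation of p. 359 read backwards: the
book deduces the three values of `ε(E/K)` from the isomorphism and the three dimensions on the
right; the tree proved the three values of `ε` first (bottom-up, bsd.S15 seat), and the
isomorphism *as stated* (existence of a linear isomorphism) follows from them and the same three
dimensions.

## Main results

* `WeierstrassCurve.natCard_torsionBy_point_eq_of_cusp` / `…_of_node` / `…_of_isElliptic`:
  `#V_ns(k)[ℓⁿ] = ℓ^{dn}` with `d = 0, 1, 2` for a cuspidal / nodal / smooth Weierstrass cubic over
  an algebraically closed field `k` with `ℓ ≠ 0` in `k`;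
* `WeierstrassCurve.isElliptic_reductionAlgClosure_of_hasGoodReductionAt`: at a good place
  `Ẽ_v ⊗ k̄_v` is an elliptic curve;
* `WeierstrassCurve.finrank_fixedSubmodule_inertia_rationalTate_eq_two_sub_codimFixed`:
  `dim (V_ℓ E)^{H} = 2 - codim (V_ℓ E)^{H}`;
* `WeierstrassCurve.exists_rank_fixedSubmodule_inertia_and_card_torsionBy_reductionPoints`: a
  common `d ≤ 2` with `dim (V_ℓ E)^{I_𝔓} = d` and `#Ẽ_ns(k̄_v)[ℓⁿ] = ℓ^{dn}` for all `n`;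
* `WeierstrassCurve.nonempty_fixedSubmodule_inertia_rationalTate_equiv_reductionPoints_holds` —
  the discharge.

## References

* J. H. Silverman, *Advanced Topics in the Arithmetic of Elliptic Curves*, GTM 151 (1994), §IV.10,
  Thm. 10.2(a) and its proof (PDF pp. 358–359: "the fundamental isomorphism"). [SilvermanATAEC1994]
* J.-P. Serre, J. Tate, *Good reduction of abelian varieties*, Ann. of Math. 88 (1968), §1,
  Lemma 2. [SerreTate1968]
* J. H. Silverman, *The Arithmetic of Elliptic Curves*, 2nd ed. (2009), III.2.5, III.6.4(b),
  III.7.1, VII.4.1, VII.5.1. [SilvermanAEC2009]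

## Design

No definitions, no `sorry`; `noncomputable section`, `open scoped Classical` (group law on
`Affine.Point`), one universe `u` as in the fact file; deliberate dot-notation extensions of
Mathlib's `WeierstrassCurve` namespace, as in the fact file and its siblings (the discharge must
carry the fact's name `WeierstrassCurve.…_holds`).  A separate file because
`InertiaInvariantsAdditiveProofs` (Thm. IV.10.2(a), additive case) transitively imports both
`HasseWeilAbelianInertiaInvariants` and `HasseWeilAbelianInertiaInvariantsProofs`.
-/

noncomputable section

open scoped Classical NumberField AddSubgroup
open Field IsDedekindDomain

universe u

namespace WeierstrassCurve

open Literature.NumberTheory.EllipticCurves Literature.NumberTheory.GaloisRepresentations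

/-! ### Torsion counts `#V_ns(k)[ℓⁿ]` over an algebraically closed field -/

section TorsionCounts

variable {k : Type u} [Field k] [IsAlgClosed k] (V : WeierstrassCurve k) (ℓ : ℕ)

/-- For a cuspidal Weierstrass cubic `V` (`Δ = 0 = c₄`) over an algebraically closed field in
which `ℓ ≠ 0`, `#V_ns(k)[ℓⁿ] = 1 = ℓ^{0·n}`: `V_ns(k) ≅ k⁺` (*AEC* III.2.5(b),
`nonempty_point_addEquiv_of_cusp`) has no `ℓ`-torsion.  Silverman, *ATAEC*, proof of
Thm. IV.10.2(a), PDF p. 359: "`V_ℓ(k̄⁺) = 0`".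
[cite: SilvermanATAEC1994, proof of Thm. IV.10.2(a) (PDF p. 359)] -/
theorem natCard_torsionBy_point_eq_of_cusp (hΔ : V.Δ = 0) (hc₄ : V.c₄ = 0) (hℓ : (ℓ : k) ≠ 0)
    (n : ℕ) : Nat.card ((V.toAffine.Point)[(ℓ ^ n : ℕ)]) = ℓ ^ (0 * n) := by
  obtain ⟨e⟩ := V.nonempty_point_addEquiv_of_cusp hΔ hc₄
  rw [natCard_torsionBy_eq_of_addEquiv e, zero_mul, pow_zero]
  exact natCard_torsionBy_eq_one_of_natCast_ne_zero k (by exact_mod_cast pow_ne_zero n hℓ)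

/-- For a nodal Weierstrass cubic `V` (`Δ = 0 ≠ c₄`) over an algebraically closed field in which
`ℓ ≠ 0`, `#V_ns(k)[ℓⁿ] = ℓⁿ`: `V_ns(k) ≅ kˣ` (*AEC* III.2.5(a),
`nonempty_point_addEquiv_units_of_node`) and `#μ_{ℓⁿ}(k) = ℓⁿ`
(Mathlib `HasEnoughRootsOfUnity.natCard_rootsOfUnity`).  Silverman, *ATAEC*, proof of
Thm. IV.10.2(a), PDF p. 359: "`V_ℓ(k̄^*) ≅ ℚ_ℓ`".
[cite: SilvermanATAEC1994, proof of Thm. IV.10.2(a) (PDF p. 359)] -/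
theorem natCard_torsionBy_point_eq_of_node (hΔ : V.Δ = 0) (hc₄ : V.c₄ ≠ 0) (hℓ : (ℓ : k) ≠ 0)
    (n : ℕ) : Nat.card ((V.toAffine.Point)[(ℓ ^ n : ℕ)]) = ℓ ^ (1 * n) := by
  obtain ⟨e⟩ := V.nonempty_point_addEquiv_units_of_node hΔ hc₄
  haveI : NeZero (ℓ : k) := ⟨hℓ⟩
  haveI : NeZero (ℓ ^ n) := ⟨pow_ne_zero n (by rintro rfl; exact hℓ Nat.cast_zero)⟩
  -- `(kˣ)[ℓⁿ]`, written additively, is `μ_{ℓⁿ}(k)`, of order `ℓⁿ`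
  have hc : Nat.card ((Additive kˣ)[(ℓ ^ n : ℕ)]) = Nat.card (rootsOfUnity (ℓ ^ n) k) := by
    refine Nat.card_congr (Additive.toMul.subtypeEquiv fun x ↦ ?_)
    change x ∈ (Additive kˣ)[(ℓ ^ n : ℕ)] ↔ Additive.toMul x ∈ rootsOfUnity (ℓ ^ n) k
    rw [AddSubgroup.torsionBy.nsmul_iff, mem_rootsOfUnity, ← toMul_nsmul, ← toMul_zero,
      Additive.toMul.apply_eq_iff_eq]
  rw [natCard_torsionBy_eq_of_addEquiv e, one_mul, hc]
  exact HasEnoughRootsOfUnity.natCard_rootsOfUnity k (ℓ ^ n)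

/-- For an elliptic curve `V` over an algebraically closed field in which `ℓ ≠ 0`,
`#V(k)[ℓⁿ] = ℓ^{2n}` — Silverman, *AEC* III.6.4(b) (`card_torsionBy_eq_sq`, `TorsionCardinality`),
the input of *ATAEC* p. 359 "`V_ℓ(Ẽ) ≅ ℚ_ℓ²`". [cite: SilvermanAEC2009, Cor. III.6.4(b)] -/
theorem natCard_torsionBy_point_eq_of_isElliptic [V.IsElliptic] (hℓ : (ℓ : k) ≠ 0) (n : ℕ) :
    Nat.card ((V.toAffine.Point)[(ℓ ^ n : ℕ)]) = ℓ ^ (2 * n) := by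
  rw [pow_mul']
  exact V.card_torsionBy_eq_sq (by exact_mod_cast pow_ne_zero n hℓ)

end TorsionCounts

/-! ### The two dimensions at a finite place `v ∤ ℓ` of a number field -/

section NumberField

variable {K : Type u} [Field K] [NumberField K] (W : WeierstrassCurve K) (ℓ : ℕ) [Fact ℓ.Prime]

/-- At a place of good reduction the reduced minimal model `Ẽ_v ⊗ k̄_v` (`reductionAlgClosure`) is
an elliptic curve: Mathlib `hasGoodReduction_iff_isElliptic_reduction` (`v(Δ_min) = 0`), and
ellipticity is preserved by base change.  Silverman, *AEC* VII.5.1(a). [folklore] -/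
theorem isElliptic_reductionAlgClosure_of_hasGoodReductionAt {v : HeightOneSpectrum (𝓞 K)}
    (hv : W.HasGoodReductionAt v) : (W.reductionAlgClosure v).IsElliptic := by
  haveI : ((W.localMinimalModel v).reduction (v.adicCompletionIntegers K)).IsElliptic :=
    (hasGoodReduction_iff_isElliptic_reduction (R := v.adicCompletionIntegers K)).mp hv
  infer_instance

/-- `dim_{ℚ_ℓ} (V_ℓ E)^{H} = 2 - codim (V_ℓ E)^{H}` for every subgroup `H ≤ Γ_K` — Silverman,
*ATAEC*, §IV.10, Definition of the tame part (PDF p. 358):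
`ε(E/K) = dim (V_ℓ E / V_ℓ(E)^{I}) = 2 - dim V_ℓ(E)^{I}`, with `dim V_ℓ E = 2` (*AEC* III.7.1,
`finrank_rationalTateModule_eq_two_holds`).
[cite: SilvermanATAEC1994, §IV.10, Definition preceding Thm. 10.2 (PDF p. 358)] -/
theorem finrank_fixedSubmodule_inertia_rationalTate_eq_two_sub_codimFixed [W.IsElliptic]
    (h : Continuous fun x : absoluteGaloisGroup K × RationalTateModule (geomPoints W) ℓ ↦
      rationalTateRepresentation (absoluteGaloisGroup K) (geomPoints W) ℓ x.1 x.2)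
    (H : Subgroup (absoluteGaloisGroup K)) :
    Module.finrank ℚ_[ℓ] ((rationalTateGaloisRepOf (geomPoints W) ℓ h).fixedSubmodule H) =
      2 - (rationalTateGaloisRepOf (geomPoints W) ℓ h).codimFixed H := by
  have hℓK : (ℓ : K) ≠ 0 := Nat.cast_ne_zero.mpr (Fact.out : ℓ.Prime).ne_zero
  haveI : Module.Finite ℚ_[ℓ] (RationalTateModule (geomPoints W) ℓ) := W.finite_rationalTateModule ℓ
  have h2 : Module.finrank ℚ_[ℓ] (RationalTateModule (geomPoints W) ℓ) = 2 :=
    finrank_rationalTateModule_eq_two_holds W ℓ hℓK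
  have hcod := (rationalTateGaloisRepOf (geomPoints W) ℓ h).codimFixed_eq_finrank_sub H
  have hle := ((rationalTateGaloisRepOf (geomPoints W) ℓ h).fixedSubmodule H).finrank_le
  change _ = Module.finrank ℚ_[ℓ] (RationalTateModule (geomPoints W) ℓ) - _ at hcod
  change _ ≤ Module.finrank ℚ_[ℓ] (RationalTateModule (geomPoints W) ℓ) at hle
  omega

/-- **The two sides of the fundamental isomorphism have the same dimension.**  At a finite place
`v ∤ ℓ` and a prime `𝔓 ∣ v` there is a `d ≤ 2` with `dim_{ℚ_ℓ} (V_ℓ E)^{I_𝔓} = d` and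
`#Ẽ_ns(k̄_v)[ℓⁿ] = ℓ^{dn}` for all `n`: `d = 2, 1, 0` at good, multiplicative, additive `v`, by
Silverman *ATAEC* Thm. IV.10.2(a) (all three cases theorems of the tree:
`codimFixed_inertia_rationalTate_eq_zero_of_hasGoodReductionAt`,
`codimFixed_inertia_rationalTate_eq_one_of_hasMultiplicativeReductionAt_holds`,
`codimFixed_inertia_rationalTate_eq_two_of_hasAdditiveReductionAt_holds`) on the left, and by
*AEC* VII.5.1 with III.6.4(b) / III.2.5 on the right (the computation of PDF p. 359,
"`V_ℓ(Ẽ) ≅ ℚ_ℓ²`, `V_ℓ(k̄^*) ≅ ℚ_ℓ`, `V_ℓ(k̄⁺) = 0`").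
[cite: SilvermanATAEC1994, Thm. IV.10.2(a) and its proof (PDF pp. 358–359)] -/
theorem exists_rank_fixedSubmodule_inertia_and_card_torsionBy_reductionPoints [W.IsElliptic]
    (h : Continuous fun x : absoluteGaloisGroup K × RationalTateModule (geomPoints W) ℓ ↦
      rationalTateRepresentation (absoluteGaloisGroup K) (geomPoints W) ℓ x.1 x.2)
    (v : HeightOneSpectrum (𝓞 K)) (hℓ : (ℓ : 𝓞 K) ∉ v.asIdeal)
    {𝔓 : Ideal (absIntegers (𝓞 K) K)} (h𝔓 : 𝔓 ∈ v.primesAbove) :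
    ∃ d : ℕ, d ≤ 2 ∧
      Module.finrank ℚ_[ℓ]
          ((rationalTateGaloisRepOf (geomPoints W) ℓ h).fixedSubmodule
            (𝔓.inertia (absoluteGaloisGroup K))) = d ∧
        ∀ n, Nat.card (((W.reductionAlgClosure v).toAffine.Point)[(ℓ ^ n : ℕ)]) = ℓ ^ (d * n) := by
  have hℓk := natCast_algebraicClosure_residueField_ne_zero (K := K) hℓ
  have hfix := W.finrank_fixedSubmodule_inertia_rationalTate_eq_two_sub_codimFixed ℓ h
    (𝔓.inertia (absoluteGaloisGroup K))
  rcases W.hasGoodReductionAt_or_hasMultiplicativeReductionAt_or_hasAdditiveReductionAt v with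
    hv | hv | hv
  · -- good reduction: `codim = 0`, `Ẽ_v` elliptic
    haveI := W.isElliptic_reductionAlgClosure_of_hasGoodReductionAt hv
    refine ⟨2, le_rfl, ?_, natCard_torsionBy_point_eq_of_isElliptic _ ℓ hℓk⟩
    rw [hfix, W.codimFixed_inertia_rationalTate_eq_zero_of_hasGoodReductionAt ℓ h hv hℓ h𝔓]
  · -- multiplicative reduction: `codim = 1`, `Ẽ_v` nodal
    obtain ⟨hΔ, hc₄⟩ :=
      W.reductionAlgClosure_Δ_eq_zero_and_c₄_ne_zero_of_hasMultiplicativeReductionAt hv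
    refine ⟨1, by norm_num, ?_, natCard_torsionBy_point_eq_of_node _ ℓ hΔ hc₄ hℓk⟩
    rw [hfix, W.codimFixed_inertia_rationalTate_eq_one_of_hasMultiplicativeReductionAt_holds ℓ h v
      hℓ hv h𝔓]
  · -- additive reduction: `codim = 2`, `Ẽ_v` cuspidal
    obtain ⟨hΔ, hc₄⟩ :=
      W.reductionAlgClosure_Δ_eq_zero_and_c₄_eq_zero_of_hasAdditiveReductionAt hv
    refine ⟨0, by norm_num, ?_, natCard_torsionBy_point_eq_of_cusp _ ℓ hΔ hc₄ hℓk⟩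
    rw [hfix, W.codimFixed_inertia_rationalTate_eq_two_of_hasAdditiveReductionAt_holds ℓ h v hℓ
      hv h𝔓]

/-- **The fundamental isomorphism `V_ℓ(E(K̄))^{I(K̄/K)} ≅ V_ℓ(Ẽ_ns(k̄))` is a theorem** — the
named fact `nonempty_fixedSubmodule_inertia_rationalTate_equiv_reductionPoints W ℓ` of
`HasseWeilAbelianInertiaInvariants` (Silverman, *Advanced Topics in the Arithmetic of Elliptic
Curves*, proof of Thm. IV.10.2(a), PDF p. 359: *"which proves the fundamental isomorphism"*;
Serre–Tate 1968, §1 Lemma 2): for an elliptic curve `E/K` over a number field, a prime `ℓ`,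
a finite place `v ∤ ℓ` and a prime `𝔓 ∣ v` of `\bar ℤ_K`, the inertia invariants `(V_ℓ E)^{I_𝔓}`
and the rational Tate module of the non-singular points of the reduced minimal model over `k̄_v`
are `ℚ_ℓ`-linearly isomorphic.  Proof: both are finite-dimensional of the same dimension `d`
(`exists_rank_fixedSubmodule_inertia_and_card_torsionBy_reductionPoints`,
`RationalTateModule.finrank_eq_of_card_torsionBy`), hence isomorphic (`LinearEquiv.ofFinrankEq`).
[cite: SilvermanATAEC1994, proof of Thm. IV.10.2(a), "the fundamental isomorphism" (PDF p. 359)] -/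
theorem nonempty_fixedSubmodule_inertia_rationalTate_equiv_reductionPoints_holds :
    W.nonempty_fixedSubmodule_inertia_rationalTate_equiv_reductionPoints ℓ := by
  intro _ h v hℓ 𝔓 h𝔓
  obtain ⟨d, -, hL, hcard⟩ :=
    W.exists_rank_fixedSubmodule_inertia_and_card_torsionBy_reductionPoints ℓ h v hℓ h𝔓
  haveI : Module.Finite ℚ_[ℓ] (RationalTateModule (geomPoints W) ℓ) := W.finite_rationalTateModule ℓ
  haveI := RationalTateModule.finite_of_card_torsionBy_rank hcard
  have hR :
      Module.finrank ℚ_[ℓ] (RationalTateModule (W.reductionAlgClosure v).toAffine.Point ℓ) = d :=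
    RationalTateModule.finrank_eq_of_card_torsionBy hcard
  exact ⟨LinearEquiv.ofFinrankEq _ _ (hL.trans hR.symm)⟩

end NumberField

end WeierstrassCurve

end
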